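import Mathlib
import HarnessLib.Audit
import Summits.PneNP.PneNP.Theorems.PstarChordReadPairCore
import Summits.PneNP.PneNP.Theorems.PstarGapTwoTerminal

/-!
# Rank below six means at most two chords: induced matchings in the AND-graph (ROUND-24, O1 at exact tightness; memo g21 §17.5)

FRONTIER range-avoidance ladder, rung F-N3, ROUND 24 (cell `pnp-ideate`, prover-2 memo `g21/O1-CHORD-READ-g21.md` §17.5; typed target
`PstarCoreBoundTargets.TerminalPeelable` (p646951); restricted-model proof complexity — nothing here bears on `P` versus `NP`).

`PstarCoincidenceRank` shows that in an empty-core coincidence both G-constraints have polar rank `< 6`.  This file turns the rank bound into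
output counting:

* `finrank_ker_add_le_of_inducedMatching` — for any edge list over a field, `dim ker(polar) + 2·|M| ≤ dim` for every induced matching `M`
  (`PstarProductRank.IsInducedMatching.ker_inf_span_eq_bot`: the radical misses the coordinate span of the `2|M|` covered vertices);
* `isInducedMatching_of_chords` — the CHORDS of a family `F` (outputs whose two AND variables are `F`-private, `PstarChordRepair.IsChord I F`)
  form an induced matching of the AND-graph of `F` (pure instance: no loops; privacy: disjoint and induced);
* **`six_le_of_three_chords`** — three distinct chords of `F` give `dim rad(polar F) + 6 ≤ n`;
* **`card_chords_le_two_of_rank_lt_six`** — so a family whose AND-sum has polar rank `< 6` has AT MOST TWO chords.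

With `PstarPairCoreNormal.PairCore.normalForm`: in the empty-core branch of a pair-core of the chord `c`, the folded family `F₁` (with `c + F₁`
everywhere even) has at most two `F₁`-chords and `G ∪ F₂` at most two `(G ∪ F₂)`-chords.  At maximal sharing (the tight twelve-output centre
structures, where every non-chord of `J₀` is a half-chord whose shared variable has multiplicity two) an output of `F₁` fails to be an `F₁`-chord
only if its sharing partner also lies in `F₁`; so `#F₁ ≤ 4` and `c` closes an XOR cycle of length `≤ 5` through at most two AND-components — the
kernel form of "the only defects are 3-cycles" (memo §15.2), for the planner's census.  No Assumption A.
-/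

set_option linter.dupNamespace false -- `Summit.PneNP.PneNP.…`: summit = sub-problem name (D-0017 single-conjunct layout)

open Finset Module Literature.Computability.Complexity
open Summit.PneNP.PneNP.Theorems.PstarSALevel (varSet bdry SimpleOverlap)
open Summit.PneNP.PneNP.Theorems.PstarCentreFree (vars_mem_varSet)
open Summit.PneNP.PneNP.Theorems.PstarNorCoreTools (not_mem_bdry_of_two)
open Summit.PneNP.PneNP.Theorems.PstarChordRepair (IsChord)
open Summit.PneNP.PneNP.Theorems.PstarQuadRank (rad)
open Summit.PneNP.PneNP.Theorems.PstarProductRank (polar cover mem_cover IsInducedMatching)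

namespace Summit.PneNP.PneNP.Theorems.PstarCoincidenceMatching

/-! ## Rank versus induced matchings (any field) -/
section Matching

variable {K : Type*} [Field K] {ι κ : Type*} [Fintype ι] [DecidableEq ι] {J M : Finset κ} {p q : κ → ι}

/-- **The kernel of the adjacency form has codimension at least twice the induced matching number.** -/
theorem finrank_ker_add_le_of_inducedMatching (hM : IsInducedMatching J M p q) :
    finrank K (LinearMap.ker (polar (K := K) J p q)) + 2 * M.card ≤ finrank K (ι → K) := by
  set B : LinearMap.BilinForm K (ι → K) := polar J p q with hB
  set S : Submodule K (ι → K) := Submodule.span K (Set.range fun c : cover M p q => Pi.single (c : ι) (1 : K)) with hS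
  have hScard : finrank K S = (cover M p q).card := by
    rw [hS, finrank_span_eq_card, Fintype.card_coe]
    exact (Pi.linearIndependent_single_one ι K).comp _ Subtype.val_injective
  have hker : LinearMap.ker B ⊓ S = ⊥ := hM.ker_inf_span_eq_bot
  have h3 : finrank K (LinearMap.ker B) + finrank K S ≤ finrank K (ι → K) := by
    have e := Submodule.finrank_sup_add_finrank_inf_eq (LinearMap.ker B) S
    rw [hker, finrank_bot, add_zero] at e
    rw [← e]
    exact Submodule.finrank_le _
  have hcov : (cover M p q).card = 2 * M.card := hM.card_cover
  rw [hScard, hcov] at h3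
  exact h3

end Matching

/-! ## Chords of a family form an induced matching of its AND-graph -/
section Chords

variable {n m : ℕ} (I : LocalMap 4 n m)

/-- **The chords of `F` form an induced matching** of the AND-graph of `F` (edge list `f ↦ {vars f 2, vars f 3}` over `F`). -/
theorem isInducedMatching_of_chords (hI : I.IsPure xorAndPred) {F M : Finset (Fin m)} (hMF : M ⊆ F) (hch : ∀ f ∈ M, IsChord I F f) :
    IsInducedMatching F M (fun j => I.vars j 2) (fun j => I.vars j 3) := by
  classical
  have h23 : ∀ f, I.vars f 2 ≠ I.vars f 3 := fun f h => absurd (hI.2 f h) (by decide)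
  -- a private AND variable of `f ∈ M` lies in no other output of `F`
  have uniq : ∀ f ∈ M, ∀ j ∈ F, ∀ s s' : Fin 4, (s = 2 ∨ s = 3) → I.vars j s' = I.vars f s → j = f := by
    intro f hf j hj s s' hs he
    by_contra hne
    have hb : I.vars f s ∈ bdry I F := by
      rcases hs with rfl | rfl
      exacts [(hch f hf).1, (hch f hf).2]
    exact not_mem_bdry_of_two I hj (hMF hf) hne (he ▸ vars_mem_varSet I j s') (vars_mem_varSet I f s) hb
  refine ⟨hMF, fun f _ => h23 f, fun f hf f' hf' hne => ?_, fun j hj hp hq => ?_⟩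
  · refine ⟨fun e => hne ?_, fun e => hne ?_, fun e => hne ?_, fun e => hne ?_⟩
    · exact (uniq f' hf' f (hMF hf) 2 2 (Or.inl rfl) e).symm ▸ rfl
    · exact (uniq f' hf' f (hMF hf) 3 2 (Or.inr rfl) e).symm ▸ rfl
    · exact (uniq f' hf' f (hMF hf) 2 3 (Or.inl rfl) e).symm ▸ rfl
    · exact (uniq f' hf' f (hMF hf) 3 3 (Or.inr rfl) e).symm ▸ rfl
  · obtain ⟨f, hf, hpf⟩ := mem_cover.1 hp
    rcases hpf with e | e
    · rw [uniq f hf j hj 2 2 (Or.inl rfl) e]; exact hf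
    · rw [uniq f hf j hj 3 2 (Or.inr rfl) e]; exact hf

/-- **Three chords give rank six**: if `F` contains three distinct `F`-chords then the polar form of the AND-sum of `F` has radical of
codimension at least six. -/
theorem six_le_of_three_chords (hI : I.IsPure xorAndPred) {F : Finset (Fin m)} {f₁ f₂ f₃ : Fin m} (h₁ : f₁ ∈ F) (h₂ : f₂ ∈ F) (h₃ : f₃ ∈ F)
    (h₁₂ : f₁ ≠ f₂) (h₁₃ : f₁ ≠ f₃) (h₂₃ : f₂ ≠ f₃) (hc₁ : IsChord I F f₁) (hc₂ : IsChord I F f₂) (hc₃ : IsChord I F f₃) :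
    finrank (ZMod 2) (rad (polar F (fun j => I.vars j 2) (fun j => I.vars j 3))) + 6 ≤ finrank (ZMod 2) (Fin n → ZMod 2) := by
  classical
  have hMF : ({f₁, f₂, f₃} : Finset (Fin m)) ⊆ F := by
    intro f hf
    simp only [mem_insert, mem_singleton] at hf
    rcases hf with rfl | rfl | rfl <;> assumption
  have hch : ∀ f ∈ ({f₁, f₂, f₃} : Finset (Fin m)), IsChord I F f := by
    intro f hf
    simp only [mem_insert, mem_singleton] at hf
    rcases hf with rfl | rfl | rfl <;> assumption
  have hcard : ({f₁, f₂, f₃} : Finset (Fin m)).card = 3 := by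
    rw [card_insert_of_notMem, card_pair h₂₃]
    simp only [mem_insert, mem_singleton, not_or]
    exact ⟨h₁₂, h₁₃⟩
  have h := finrank_ker_add_le_of_inducedMatching (K := ZMod 2) (isInducedMatching_of_chords I hI hMF hch)
  rw [hcard] at h
  unfold PstarQuadRank.rad
  exact h

/-- **Rank below six means at most two chords**: the set of `F`-chords (outputs of `F` with both AND variables on the boundary of `F`) has at
most two elements. -/
theorem card_chords_le_two_of_rank_lt_six (hI : I.IsPure xorAndPred) {F : Finset (Fin m)}
    (hrank : finrank (ZMod 2) (Fin n → ZMod 2) < finrank (ZMod 2) (rad (polar F (fun j => I.vars j 2) (fun j => I.vars j 3))) + 6) :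
    (F.filter fun f => I.vars f 2 ∈ bdry I F ∧ I.vars f 3 ∈ bdry I F).card ≤ 2 := by
  classical
  by_contra h3
  push Not at h3
  obtain ⟨f₁, hf₁, f₂, hf₂, f₃, hf₃, h₁₂, h₁₃, h₂₃⟩ := two_lt_card.1 h3
  rw [mem_filter] at hf₁ hf₂ hf₃
  have h := six_le_of_three_chords I hI hf₁.1 hf₂.1 hf₃.1 h₁₂ h₁₃ h₂₃ hf₁.2 hf₂.2 hf₃.2
  omega

end Chords

/-! ## Appendix: induced matchings of size three -/
section Three

variable {n m : ℕ} (I : LocalMap 4 n m)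

/-- **Rank below six means no induced matching of three AND pairs** (the general form of `card_chords_le_two_of_rank_lt_six`; with one output per
AND-connected component this reads: at most two AND-components). -/
theorem card_inducedMatching_le_two_of_rank_lt_six {F M : Finset (Fin m)} (hM : IsInducedMatching F M (fun j => I.vars j 2) (fun j => I.vars j 3))
    (hrank : finrank (ZMod 2) (Fin n → ZMod 2) < finrank (ZMod 2) (rad (polar F (fun j => I.vars j 2) (fun j => I.vars j 3))) + 6) :
    M.card ≤ 2 := by
  have h := finrank_ker_add_le_of_inducedMatching (K := ZMod 2) hM
  unfold PstarQuadRank.rad at hrank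
  omega

end Three

end Summit.PneNP.PneNP.Theorems.PstarCoincidenceMatching
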